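import Literature.Algebra.Homology.TwistedCoinvariantsOrbitFactors
import HarnessLib

/-!
# Twisted coinvariants of a module with a direct product decomposition: the EXPLICIT FORMULA for the orbit-factor isomorphism —
# a vector supported at the coordinate `i = φ(t)·i₀(O)` goes to `single_O (χ(t)·[π_{i₀(O)}(φ(t)⁻¹ v)])`, and a general vector to the fibre sums (Brown III (5.3), (6.2))

Topic `Algebra/Homology`; namespace `Literature.Algebra.Homology.InducedModule`, continuing `TwistedCoinvariantsOrbitFactors.lean` (★★★ `quotTwistRelEquivPiOrbitFactors`,
computed there only on vectors supported at a BASE coordinate, `_mk_of_mem`).  Here: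
* §1 `mkQ_eq_smul_mkQ_apply_inv` (`[v] = χ(t)·[φ(t)⁻¹ v]`), `apply_inv_mem_coordSummand_orbitBase` (for `v ∈ M_i`, `φ(t) i₀(O) = i`: `φ(t)⁻¹ v ∈ M_{i₀(O)}`),
  ★★ **`quotTwistRelEquivPiOrbitFactors_mk_of_mem_of_smul_eq`**: `e [v] = single_O (χ(t) • [π_{i₀(O)} (φ(t)⁻¹ v)])` for `v ∈ M_i` and ANY `t ∈ Υ` with `φ(t) i₀(O) = i`
  (choice-free; the multi-orbit, product-coordinate form of S81's `P[v] = Σ_i χ(s_i)[φ(s_i)⁻¹ v_i]`);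
* §2 `eq_sum_coordSummandEquiv_symm` (`v = Σ_i ṽ_i`, `ṽ_i ∈ M_i` the lift of the `i`-th coordinate) and ★★ **`quotTwistRelEquivPiOrbitFactors_mk_eq_sum`**:
  `e [v] = Σ_i single_{O(i)} (χ(t_i) • [π_{i₀(O(i))} (φ(t_i)⁻¹ ṽ_i)])` for ANY family of transporters `t_i` (`φ(t_i) i₀(O(i)) = i`).
Use (cell `bsd-print-cf2`, brick §4(c)/(e)): for a GLOBAL unit `u` (diagonal in `∏_{w∣v} U¹_w`, e.g. an elliptic unit) the `O`-component of its class is the `χ`-weighted sum over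
the places `w ∈ O` of the transports of `u_w` to the base place — de Shalit's / the LEAD's coset sums `Σ_t χ(t)·[(u^{t⁻¹})_𝔓]` (memos BRICK-C-PADIC-g20 F26, BRICK-C-SHAPIRO-g21
F29); and the NATURALITY of the orbit factors under an equivariant block-compatible map (the semi-local norm) follows from §1 by linearity.
Theorems only; no definition, no named fact, no `sorry`, no instance.

## References
* [Brown1982CohomologyGroups] K. S. Brown, *Cohomology of Groups* (1982), II §2; III §5 Prop. (5.3), (5.4), (5.8); III §6 (6.2).
* [deShalit1987] E. de Shalit, *Iwasawa theory of elliptic curves with complex multiplication* (1987), III §1.3–1.4 (the semi-local decomposition of `U_∞`).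
-/

noncomputable section

universe u

namespace Literature.Algebra.Homology

namespace InducedModule

open Representation DirectSum CoinducedModule

variable {k G : Type u} [CommRing k] [Group G] {V : Type u} [AddCommGroup V] [Module k V]
  (N : Representation k G V) {Υ : Type u} [Group Υ] (φ : Υ →* G) (χ : Υ →* kˣ)
  {I : Type u} [MulAction G I] {A : I → Type u} [∀ i, AddCommGroup (A i)] [∀ i, Module k (A i)] (π : ∀ i, V →ₗ[k] A i)
  (hker : ∀ (g : G) (i : I), LinearMap.ker (π (g • i) ∘ₗ N g) = LinearMap.ker (π i))
  (hbij : Function.Bijective (LinearMap.pi π))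

/-! ## §1. The class of a vector supported at one coordinate -/

omit [MulAction G I] in
/-- **`[v] = χ(t)·[φ(t)⁻¹ v]`** in `V_{Υ,χ}`. [cite: Brown1982CohomologyGroups, II §2] -/
theorem mkQ_eq_smul_mkQ_apply_inv (t : Υ) (v : V) :
    (twistRel N φ χ).mkQ v = ((χ t : kˣ) : k) • (twistRel N φ χ).mkQ (N (φ t)⁻¹ v) := by
  conv_lhs => rw [show v = N (φ t) (N (φ t)⁻¹ v) by rw [← Module.End.mul_apply, ← map_mul, mul_inv_cancel, map_one, Module.End.one_apply]]
  exact mkQ_apply_eq_smul N φ χ t _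

include hker in
/-- For `v ∈ M_i` and `φ(t) i₀ = i`: `φ(t)⁻¹ v ∈ M_{i₀}`. [cite: Brown1982CohomologyGroups, III §5 Prop. (5.3), (5.8)] -/
theorem apply_inv_mem_coordSummand_of_smul_eq {i i₀ : I} {v : V} (hv : v ∈ coordSummand π i) (t : Υ) (ht : φ t • i₀ = i) :
    N (φ t)⁻¹ v ∈ coordSummand π i₀ := by
  have h := coordSummand_map_le N π hker (φ t)⁻¹ i ⟨v, hv, rfl⟩
  rwa [inv_smul_eq_iff.mpr ht.symm] at h

/-- The orbit of a coordinate `i` meets its base point: some `t ∈ Υ` has `φ(t)·i₀(O(i)) = i`. [cite: Brown1982CohomologyGroups, III §5 Prop. (5.3)] -/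
theorem exists_smul_orbitBase_eq_self (i : I) :
    ∃ t : Υ, φ t • ((orbitBase φ (orbitLabel φ i) : {j // orbitLabel φ j = orbitLabel φ i}) : I) = i :=
  exists_smul_orbitBase_eq φ (orbitLabel φ i) ⟨i, rfl⟩

variable [DecidableEq I] [Fintype I] [Fintype (Quotient (orbitSetoid φ (I := I)))] [DecidableEq (Quotient (orbitSetoid φ (I := I)))]


/-- ★★ **THE ORBIT-FACTOR ISOMORPHISM ON A VECTOR SUPPORTED AT ANY COORDINATE**: for `v ∈ M_i`, `O` the orbit of `i` and ANY `t ∈ Υ` with `φ(t)·i₀(O) = i`,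
`e [v] = single_O (χ(t) • [π_{i₀(O)} (φ(t)⁻¹ v)])` — transport `v` back to the base coordinate and weight by `χ(t)` (independent of the choice of `t`).
[cite: Brown1982CohomologyGroups, III §5 Prop. (5.3); III §6 (6.2)] [cite: deShalit1987, III §1.3–1.4] -/
theorem quotTwistRelEquivPiOrbitFactors_mk_of_mem_of_smul_eq (c : Quotient (orbitSetoid φ (I := I))) {i : I} {v : V} (hv : v ∈ coordSummand π i)
    (t : Υ) (ht : φ t • ((orbitBase φ c : {i // orbitLabel φ i = c}) : I) = i) :
    quotTwistRelEquivPiOrbitFactors N φ χ π hker hbij (Submodule.Quotient.mk v) =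
      Pi.single c (((χ t : kˣ) : k) • Submodule.Quotient.mk (π ((orbitBase φ c : {i // orbitLabel φ i = c}) : I) (N (φ t)⁻¹ v))) := by
  have h1 : (Submodule.Quotient.mk v : V ⧸ twistRel N φ χ) = ((χ t : kˣ) : k) • Submodule.Quotient.mk (N (φ t)⁻¹ v) :=
    mkQ_eq_smul_mkQ_apply_inv N φ χ t v
  rw [h1, map_smul, quotTwistRelEquivPiOrbitFactors_mk_of_mem N φ χ π hker hbij c (apply_inv_mem_coordSummand_of_smul_eq N φ π hker hv t ht),
    Pi.single_smul]

/-! ## §2. The class of an arbitrary vector: fibre sums -/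

omit [MulAction G I] [Fintype (Quotient (orbitSetoid φ (I := I)))] [DecidableEq (Quotient (orbitSetoid φ (I := I)))] in
/-- **`v = Σ_i ṽ_i`** with `ṽ_i = (coordSummandEquiv i)⁻¹ (π_i v) ∈ M_i` the lift of the `i`-th coordinate (both sides have the same coordinates).
[cite: Brown1982CohomologyGroups, III §5 Prop. (5.8), (5.9)] -/
theorem eq_sum_coordSummandEquiv_symm (v : V) : v = ∑ i, ((coordSummandEquiv π hbij i).symm (π i v) : V) := by
  refine sub_eq_zero.mp (eq_zero_of_forall_pi_eq_zero π hbij fun j => ?_)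
  rw [map_sub, map_sum, Finset.sum_eq_single j (fun i _ hij => pi_coordSummandEquiv_symm_apply_of_ne π hbij hij.symm (π i v))
    (fun h => absurd (Finset.mem_univ j) h), pi_coordSummandEquiv_symm_apply, sub_self]

/-- ★★ **THE ORBIT-FACTOR ISOMORPHISM ON AN ARBITRARY VECTOR**: for ANY family of transporters `t_i ∈ Υ` (`φ(t_i)·i₀(O(i)) = i`),
`e [v] = Σ_i single_{O(i)} (χ(t_i) • [π_{i₀(O(i))} (φ(t_i)⁻¹ ṽ_i)])` with `ṽ_i` the lift of the `i`-th coordinate of `v` — so the `O`-component of `e [v]` is the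
`χ`-weighted sum over the coordinates `i ∈ O` of the transports of `ṽ_i` to the base coordinate (S81's `P[v] = Σ_i χ(s_i)[φ(s_i)⁻¹ v_i]` in product coordinates,
several orbits). [cite: Brown1982CohomologyGroups, III §5 Prop. (5.3); III §6 (6.2)] [cite: deShalit1987, III §1.3–1.4] -/
theorem quotTwistRelEquivPiOrbitFactors_mk_eq_sum (v : V) (t : I → Υ)
    (ht : ∀ i, φ (t i) • ((orbitBase φ (orbitLabel φ i) : {j // orbitLabel φ j = orbitLabel φ i}) : I) = i) :
    quotTwistRelEquivPiOrbitFactors N φ χ π hker hbij (Submodule.Quotient.mk v) =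
      ∑ i, Pi.single (orbitLabel φ i) (((χ (t i) : kˣ) : k) •
        Submodule.Quotient.mk (π ((orbitBase φ (orbitLabel φ i) : {j // orbitLabel φ j = orbitLabel φ i}) : I)
          (N (φ (t i))⁻¹ ((coordSummandEquiv π hbij i).symm (π i v) : V)))) := by
  conv_lhs => rw [eq_sum_coordSummandEquiv_symm π hbij v]
  rw [← Submodule.mkQ_apply, map_sum, map_sum]
  exact Finset.sum_congr rfl fun i _ =>
    quotTwistRelEquivPiOrbitFactors_mk_of_mem_of_smul_eq N φ χ π hker hbij (orbitLabel φ i) ((coordSummandEquiv π hbij i).symm (π i v)).2 (t i) (ht i)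

/-- **The `O`-component**: `(e [v])_O = Σ_{i : O(i) = O} χ(t_i) • [π_{i₀(O)} (φ(t_i)⁻¹ ṽ_i)]`, here in the form «sum over all `i` of the `O`-components of the singles».
[cite: Brown1982CohomologyGroups, III §6 (6.2)] [cite: deShalit1987, III §1.3–1.4] -/
theorem quotTwistRelEquivPiOrbitFactors_mk_apply_eq_sum (v : V) (t : I → Υ)
    (ht : ∀ i, φ (t i) • ((orbitBase φ (orbitLabel φ i) : {j // orbitLabel φ j = orbitLabel φ i}) : I) = i) (c : Quotient (orbitSetoid φ (I := I))) :
    quotTwistRelEquivPiOrbitFactors N φ χ π hker hbij (Submodule.Quotient.mk v) c =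
      ∑ i, Pi.single (M := fun c : Quotient (orbitSetoid φ (I := I)) =>
          A ((orbitBase φ c : {j // orbitLabel φ j = c}) : I) ⧸ factorTwistRel N φ χ π hker hbij ((orbitBase φ c : {j // orbitLabel φ j = c}) : I))
        (orbitLabel φ i) (((χ (t i) : kˣ) : k) •
        Submodule.Quotient.mk (π ((orbitBase φ (orbitLabel φ i) : {j // orbitLabel φ j = orbitLabel φ i}) : I)
          (N (φ (t i))⁻¹ ((coordSummandEquiv π hbij i).symm (π i v) : V)))) c := by
  rw [quotTwistRelEquivPiOrbitFactors_mk_eq_sum N φ χ π hker hbij v t ht, Finset.sum_apply]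

end InducedModule

end Literature.Algebra.Homology

end
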